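import Mathlib.Analysis.SpecialFunctions.ImproperIntegrals
import Mathlib.Analysis.SpecialFunctions.Complex.LogDeriv
import Mathlib.Analysis.SpecialFunctions.Integrals.Basic
import Mathlib.Analysis.Complex.CauchyIntegral
import Mathlib.MeasureTheory.Integral.IntegralEqImproper
import Mathlib.MeasureTheory.Measure.Haar.NormedSpace
import HarnessLib

/-!
# The Poisson integral of the arcsine law as a mixture of Cauchy kernels

For `c > 0` and real `s` put `z = s + ic`. This file proves the identity

  `∫₀^π c dθ / (c² + (s - cos θ)²) = ∫_ℝ m(c, s, t) dt`,
  `m(c, s, t) = (1/(2b)) [ (b - s)/((b - s)² + c²) + (b + s)/((b + s)² + c²) ]`, `b = √(1 + t²)`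

(`integral_pi_poissonCos_eq_integral_cauchyMixKernel`). The left side is `π` times the Poisson
integral (harmonic extension to the upper half plane, evaluated at `z`) of the arcsine law
`dx/(π√(1 - x²))` on `(-1, 1)`; the right side exhibits it, as a function of the HEIGHT `c`, as a
positive superposition of Cauchy profiles `β/(β² + c²)` with scales `β = b ∓ s ≥ 1 - |s|`. This is
the real-variable content of the branch-cut representation `Re (1 - z²)^{-1/2} = Re ∫_ℝ dt/(t² + 1 - z²)`
and is the input for the Laplace transform of `cos(sω) J₀(ω)` and for Lieb–Wu's bounds on the
momentum density of the half-filled Hubbard chain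
(`Literature.Analysis.SpecialFunctions.BesselJZeroFermiIntegral`,
`Literature.MathematicalPhysics.QuantumLattice.LiebWuRho0Bounds`).

## Proof

* `integral_inv_sq_add_of_mem_slitPlane`: `∫_ℝ dt/(t² + w) = π / w^{1/2}` for `w` in the slit
  plane, from the antiderivative `(log(1 + itw^{-1/2}) - log(1 - itw^{-1/2}))/(2i w^{1/2})` on
  `(0, ∞)` (both logarithms stay off the cut) and its limit `πi/(2i w^{1/2})` at `+∞`.
* `integral_inv_sub_cos`: `∫₀^{2π} dθ/(z - cos θ) = 2π/D` with `D² = z² - 1`, `Im z > 0`, by the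
  Cauchy integral formula on the unit circle (`DifferentiableOn.circleIntegral_sub_inv_smul`): with
  the roots `ζ₁ζ₂ = 1`, `ζ₁ + ζ₂ = 2z` of `ζ² - 2zζ + 1`, exactly one root lies in the open unit
  disc and `e^{iθ} i (e^{iθ} - ζ₁)⁻¹ 2i/(e^{iθ} - ζ₂) = 1/(z - cos θ)`.
* Taking imaginary parts and halving the period gives `∫₀^π c dθ/(c² + (s - cos θ)²) = -π Im D⁻¹`;
  the right side of the identity is `Re(π/B)`, `B = (1 - z²)^{1/2}`; since `D² = -B²` one has
  `D = ±iB`, and the sign is fixed by the positivity of both sides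
  (`integral_pi_poissonCos_eq_integral_re`).
* `re_inv_sq_add_one_sub_sq`: `Re (t² + 1 - z²)⁻¹ = m(c, s, t)` (partial fractions in
  `t² + 1 - z² = (b - z)(b + z)`).
* Elementary properties of `m` for `|s| < 1` (positivity, monotonicity in `c`, the bound
  `m ≤ 1/((1 - |s|)(1 + t²))`, integrability, `∫ m(0, s, t) dt = π/√(1 - s²)`).

## Mathlib

`Complex.slitPlane`, `HasDerivAt.clog_real`, `integral_Ioi_of_hasDerivAt_of_tendsto`,
`integral_exp_mul_complex_Ioi`, `DifferentiableOn.circleIntegral_sub_inv_smul`, `circleIntegral`,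
`integral_univ_inv_one_add_sq`, `Measure.integral_comp_mul_left`. Mathlib has the Poisson kernel of
the disc only implicitly (circle averages) and no closed form for `∫ dθ/(z - cos θ)`.

## References

* E. H. Lieb, F. Y. Wu, *The one-dimensional Hubbard model: a reminiscence*, Physica A 321 (2003)
  1–27 = arXiv:cond-mat/0207529, §6: the identity `2∫₀^∞ e^{-cω} J₀(ω) cos(ωs) dω =
  [(-c-is)² + 1]^{-1/2} + [(c-is)² + 1]^{-1/2}` (from Gradshteyn–Ryzhik 6.611(1)) and the
  branch-cut evaluation behind their formula (rhoeye) for `ρ₀`; this file supplies the same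
  information by real-variable means.
-/

noncomputable section

open Complex MeasureTheory Set Filter Real intervalIntegral Metric
open scoped Topology

namespace Literature.Analysis.SpecialFunctions

/-! ### `∫_ℝ dt/(t² + w) = π / w^{1/2}` on the slit plane -/

/-- For `w` in the slit plane, `w^{1/2}` has positive real part. [folklore] -/
theorem re_cpow_half_pos {w : ℂ} (hw : w ∈ slitPlane) : 0 < (w ^ (1 / 2 : ℂ)).re := by
  have hw0 : w ≠ 0 := slitPlane_ne_zero hw
  rw [cpow_def_of_ne_zero hw0, Complex.exp_re]
  refine mul_pos (Real.exp_pos _) (Real.cos_pos_of_mem_Ioo ⟨?_, ?_⟩)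
  · have h1 : (Complex.log w * (1 / 2)).im = arg w / 2 := by
      simp [Complex.mul_im, Complex.log_im, div_eq_mul_inv]
    rw [h1]
    linarith [neg_pi_lt_arg w]
  · have h1 : (Complex.log w * (1 / 2)).im = arg w / 2 := by
      simp [Complex.mul_im, Complex.log_im, div_eq_mul_inv]
    rw [h1]
    have h2 : arg w ≠ π := (mem_slitPlane_iff_arg.1 hw).1
    have h3 : arg w < π := lt_of_le_of_ne (arg_le_pi w) h2
    linarith

/-- `w^{1/2} · w^{1/2} = w`. [folklore] -/
theorem cpow_half_mul_self {w : ℂ} (hw0 : w ≠ 0) : w ^ (1 / 2 : ℂ) * w ^ (1 / 2 : ℂ) = w := by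
  rw [← cpow_add _ _ hw0]
  norm_num

/-- Lower bound `|t² + w| ≥ (Re w^{1/2})²` for real `t`. [folklore] -/
theorem sq_re_cpow_half_le_norm {w : ℂ} (hw : w ∈ slitPlane) (t : ℝ) :
    (w ^ (1 / 2 : ℂ)).re ^ 2 ≤ ‖(t : ℂ) ^ 2 + w‖ := by
  set r := w ^ (1 / 2 : ℂ) with hr
  have hw0 : w ≠ 0 := slitPlane_ne_zero hw
  have hfac : (t : ℂ) ^ 2 + w = ((t : ℂ) + I * r) * ((t : ℂ) - I * r) := by
    have : ((t : ℂ) + I * r) * ((t : ℂ) - I * r) = (t : ℂ) ^ 2 - I ^ 2 * (r * r) := by ring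
    rw [this, Complex.I_sq, cpow_half_mul_self hw0]
    ring
  rw [hfac, norm_mul, sq]
  have hx : 0 < r.re := re_cpow_half_pos hw
  have h1 : r.re ≤ ‖(t : ℂ) + I * r‖ := by
    have : ((t : ℂ) + I * r).im = r.re := by simp
    calc r.re ≤ |((t : ℂ) + I * r).im| := by rw [this]; exact le_abs_self _
      _ ≤ ‖(t : ℂ) + I * r‖ := Complex.abs_im_le_norm _
  have h2 : r.re ≤ ‖(t : ℂ) - I * r‖ := by
    have : ((t : ℂ) - I * r).im = -r.re := by simp
    calc r.re ≤ |((t : ℂ) - I * r).im| := by rw [this, abs_neg]; exact le_abs_self _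
      _ ≤ ‖(t : ℂ) - I * r‖ := Complex.abs_im_le_norm _
  exact mul_le_mul h1 h2 hx.le (norm_nonneg _)

/-- `t² + w ≠ 0` for `w` in the slit plane and real `t`. [folklore] -/
theorem ofReal_sq_add_ne_zero {w : ℂ} (hw : w ∈ slitPlane) (t : ℝ) : (t : ℂ) ^ 2 + w ≠ 0 := by
  intro h
  have := sq_re_cpow_half_le_norm hw t
  rw [h, norm_zero] at this
  have hx : 0 < (w ^ (1 / 2 : ℂ)).re := re_cpow_half_pos hw
  nlinarith

/-- The integrand `(t² + w)⁻¹` is continuous in `t`. [folklore] -/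
theorem continuous_inv_sq_add {w : ℂ} (hw : w ∈ slitPlane) :
    Continuous fun t : ℝ => ((t : ℂ) ^ 2 + w)⁻¹ :=
  Continuous.inv₀ (by fun_prop) (ofReal_sq_add_ne_zero hw)

/-- The integrand `(t² + w)⁻¹` is integrable on `ℝ` (it is `O(1/(1+t²))`). [folklore] -/
theorem integrable_inv_sq_add {w : ℂ} (hw : w ∈ slitPlane) :
    Integrable fun t : ℝ => ((t : ℂ) ^ 2 + w)⁻¹ := by
  set δ : ℝ := (w ^ (1 / 2 : ℂ)).re ^ 2 with hδ
  have hδ0 : 0 < δ := pow_pos (re_cpow_half_pos hw) 2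
  set K : ℝ := (1 + ‖w‖) / δ + 1 with hK
  refine Integrable.mono' (integrable_inv_one_add_sq.const_mul K)
    (continuous_inv_sq_add hw).aestronglyMeasurable (Eventually.of_forall fun t => ?_)
  have hne := ofReal_sq_add_ne_zero hw t
  have hpos : 0 < ‖(t : ℂ) ^ 2 + w‖ := norm_pos_iff.2 hne
  have hlow : δ ≤ ‖(t : ℂ) ^ 2 + w‖ := sq_re_cpow_half_le_norm hw t
  -- `1 + t² ≤ (1 + ‖w‖) + ‖t² + w‖ ≤ K ‖t² + w‖`
  have htri : (t : ℝ) ^ 2 ≤ ‖(t : ℂ) ^ 2 + w‖ + ‖w‖ := by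
    have h := norm_sub_le ((t : ℂ) ^ 2 + w) w
    have e : (t : ℂ) ^ 2 + w - w = (t : ℂ) ^ 2 := by ring
    rw [e] at h
    have : ‖(t : ℂ) ^ 2‖ = t ^ 2 := by
      rw [norm_pow, Complex.norm_real, Real.norm_eq_abs, sq_abs]
    linarith
  have hkey : 1 + t ^ 2 ≤ K * ‖(t : ℂ) ^ 2 + w‖ := by
    rw [hK, add_mul, one_mul, div_mul_eq_mul_div]
    have h1 : 1 + ‖w‖ ≤ (1 + ‖w‖) * ‖(t : ℂ) ^ 2 + w‖ / δ := by
      rw [le_div_iff₀ hδ0]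
      exact mul_le_mul_of_nonneg_left hlow (by positivity)
    linarith
  rw [norm_inv, inv_le_iff_one_le_mul₀ hpos]
  have h1t : 0 < 1 + t ^ 2 := by positivity
  calc (1 : ℝ) = (1 + t ^ 2)⁻¹ * (1 + t ^ 2) := by field_simp
    _ ≤ (1 + t ^ 2)⁻¹ * (K * ‖(t : ℂ) ^ 2 + w‖) := by gcongr
    _ = K * (1 + t ^ 2)⁻¹ * ‖(t : ℂ) ^ 2 + w‖ := by ring

/-- The algebra of the antiderivative: `(v/(1+tv) + v/(1-tv))/(2ir) = 1/(t² + r²)`, `v = i/r`.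
[folklore] -/
theorem inv_sq_add_antideriv_aux (r t : ℂ) (hr : r ≠ 0) (h1 : r + t * I ≠ 0) (h2 : r - t * I ≠ 0) :
    ((I / r) / (1 + t * (I / r)) - -(I / r) / (1 - t * (I / r))) / (2 * I * r) =
      (t ^ 2 + r * r)⁻¹ := by
  have e1 : (I / r) / (1 + t * (I / r)) = I / (r + t * I) := by
    rw [div_div]
    congr 1
    field_simp
  have e2 : -(I / r) / (1 - t * (I / r)) = -I / (r - t * I) := by
    rw [neg_div, neg_div, div_div]
    congr 2
    field_simp
  rw [e1, e2, neg_div, sub_neg_eq_add]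
  have e3 : I / (r + t * I) + I / (r - t * I) = 2 * I * r / (t ^ 2 + r * r) := by
    rw [div_add_div _ _ h1 h2]
    have : (r + t * I) * (r - t * I) = t ^ 2 + r * r := by
      ring_nf
      rw [Complex.I_sq]
      ring
    rw [this]
    congr 1
    ring
  rw [e3]
  have h2I : (2 * I * r) ≠ 0 := by
    simp [hr, Complex.I_ne_zero]
  field_simp

/-- **`∫₀^∞ dt/(t² + w) = π/(2 w^{1/2})`** for `w` in the slit plane (antiderivative
`(log(1 + itw^{-1/2}) - log(1 - itw^{-1/2}))/(2i w^{1/2})`). [folklore] -/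
theorem integral_Ioi_inv_sq_add_of_mem_slitPlane {w : ℂ} (hw : w ∈ slitPlane) :
    ∫ t : ℝ in Ioi 0, ((t : ℂ) ^ 2 + w)⁻¹ = π / (2 * w ^ (1 / 2 : ℂ)) := by
  set r := w ^ (1 / 2 : ℂ) with hr
  have hw0 : w ≠ 0 := slitPlane_ne_zero hw
  have hx : 0 < r.re := re_cpow_half_pos hw
  have hr0 : r ≠ 0 := fun h => by rw [h, Complex.zero_re] at hx; exact lt_irrefl _ hx
  have hrr : r * r = w := cpow_half_mul_self hw0
  -- `v = i / r` has positive imaginary part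
  set v : ℂ := I / r with hv
  have hvim : 0 < v.im := by
    rw [hv, Complex.div_im, Complex.I_im, Complex.I_re]
    simp only [one_mul, zero_mul, zero_div, sub_zero]
    exact div_pos hx (Complex.normSq_pos.2 hr0)
  have hv0 : v ≠ 0 := fun h => by rw [h, Complex.zero_im] at hvim; exact lt_irrefl _ hvim
  -- the antiderivative
  set A : ℝ → ℂ := fun t => (Complex.log (1 + t * v) - Complex.log (1 - t * v)) / (2 * I * r)
    with hA
  have hslit₁ : ∀ t : ℝ, 0 ≤ t → (1 + (t : ℂ) * v) ∈ slitPlane := by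
    intro t ht
    rcases ht.eq_or_lt with rfl | ht
    · simp
    · refine Or.inr ?_
      have : (1 + (t : ℂ) * v).im = t * v.im := by simp
      rw [this]
      exact (mul_pos ht hvim).ne'
  have hslit₂ : ∀ t : ℝ, 0 ≤ t → (1 - (t : ℂ) * v) ∈ slitPlane := by
    intro t ht
    rcases ht.eq_or_lt with rfl | ht
    · simp
    · refine Or.inr ?_
      have : (1 - (t : ℂ) * v).im = -(t * v.im) := by simp
      rw [this, neg_ne_zero]
      exact (mul_pos ht hvim).ne'
  have hderiv : ∀ t ∈ Ioi (0 : ℝ), HasDerivAt A (((t : ℂ) ^ 2 + w)⁻¹) t := by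
    intro t ht
    have ht0 : 0 ≤ t := le_of_lt ht
    have hd₁ : HasDerivAt (fun s : ℝ => 1 + (s : ℂ) * v) v t := by
      have := ((hasDerivAt_id t).ofReal_comp).mul_const v
      simpa using this.const_add 1
    have hd₂ : HasDerivAt (fun s : ℝ => 1 - (s : ℂ) * v) (-v) t := by
      have := ((hasDerivAt_id t).ofReal_comp).mul_const v
      simpa using this.const_sub 1
    have hl₁ := hd₁.clog_real (hslit₁ t ht0)
    have hl₂ := hd₂.clog_real (hslit₂ t ht0)
    have h := (hl₁.sub hl₂).div_const (2 * I * r)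
    -- algebra: `(v/(1+tv) + v/(1-tv)) / (2ir) = 1/(t² + w)`
    have h1' : r + (t : ℂ) * I ≠ 0 := fun h0 => by
      have := congrArg Complex.re h0
      simp at this
      linarith
    have h2' : r - (t : ℂ) * I ≠ 0 := fun h0 => by
      have := congrArg Complex.re h0
      simp at this
      linarith
    have halg : (v / (1 + (t : ℂ) * v) - -v / (1 - (t : ℂ) * v)) / (2 * I * r) =
        ((t : ℂ) ^ 2 + w)⁻¹ := by
      rw [hv, ← hrr]
      exact inv_sq_add_antideriv_aux r t hr0 h1' h2'
    exact h.congr_deriv halg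
  -- continuity at `0⁺`
  have hcontA : ContinuousWithinAt A (Ici 0) 0 := by
    refine ContinuousAt.continuousWithinAt ?_
    have hc₁ : ContinuousAt (fun s : ℝ => Complex.log (1 + (s : ℂ) * v)) 0 := by
      refine (continuousAt_clog (by simp)).comp ?_
      exact (by fun_prop : Continuous fun s : ℝ => 1 + (s : ℂ) * v).continuousAt
    have hc₂ : ContinuousAt (fun s : ℝ => Complex.log (1 - (s : ℂ) * v)) 0 := by
      refine (continuousAt_clog (by simp)).comp ?_
      exact (by fun_prop : Continuous fun s : ℝ => 1 - (s : ℂ) * v).continuousAt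
    exact (hc₁.sub hc₂).div_const _
  -- the limit at `+∞`: `log(1+tv) - log(1-tv) = log(v + 1/t) - log(-v + 1/t) → log v - log(-v) = πi`
  have hlim : Tendsto A atTop (𝓝 (π / (2 * r))) := by
    have key : ∀ t : ℝ, 0 < t → A t =
        (Complex.log (v + (t⁻¹ : ℝ)) - Complex.log (-v + (t⁻¹ : ℝ))) / (2 * I * r) := by
      intro t ht
      have htC : (t : ℂ) ≠ 0 := ofReal_ne_zero.2 ht.ne'
      have e1 : (1 + (t : ℂ) * v) = (t : ℝ) * (v + (t⁻¹ : ℝ)) := by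
        push_cast
        field_simp
        ring
      have e2 : (1 - (t : ℂ) * v) = (t : ℝ) * (-v + (t⁻¹ : ℝ)) := by
        push_cast
        field_simp
        ring
      have hn1 : v + (t⁻¹ : ℝ) ≠ 0 := by
        intro h
        have := congrArg Complex.im h
        simp at this
        exact absurd this hvim.ne'
      have hn2 : -v + (t⁻¹ : ℝ) ≠ 0 := by
        intro h
        have := congrArg Complex.im h
        simp at this
        exact absurd this hvim.ne'
      simp only [hA]
      rw [e1, e2, log_ofReal_mul ht hn1, log_ofReal_mul ht hn2]
      ring
    have hlog : Tendsto (fun t : ℝ => (Complex.log (v + (t⁻¹ : ℝ)) -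
        Complex.log (-v + (t⁻¹ : ℝ))) / (2 * I * r)) atTop
        (𝓝 ((Complex.log v - Complex.log (-v)) / (2 * I * r))) := by
      have hinv : Tendsto (fun t : ℝ => ((t⁻¹ : ℝ) : ℂ)) atTop (𝓝 0) := by
        have := tendsto_inv_atTop_zero (𝕜 := ℝ)
        exact_mod_cast (Complex.continuous_ofReal.tendsto 0).comp this
      have h1 : Tendsto (fun t : ℝ => Complex.log (v + (t⁻¹ : ℝ))) atTop (𝓝 (Complex.log v)) := by
        refine (continuousAt_clog (Or.inr hvim.ne')).tendsto.comp ?_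
        simpa using tendsto_const_nhds.add hinv
      have h2 : Tendsto (fun t : ℝ => Complex.log (-v + (t⁻¹ : ℝ))) atTop
          (𝓝 (Complex.log (-v))) := by
        have hneg : (-v).im ≠ 0 := by simp [hvim.ne']
        refine (continuousAt_clog (Or.inr hneg)).tendsto.comp ?_
        simpa using tendsto_const_nhds.add hinv
      exact (h1.sub h2).div_const _
    have hval : (Complex.log v - Complex.log (-v)) / (2 * I * r) = π / (2 * r) := by
      have : Complex.log (-v) = Complex.log v - π * I := by
        rw [Complex.log, Complex.log, arg_neg_eq_arg_sub_pi_of_im_pos hvim, norm_neg]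
        push_cast
        ring
      rw [this]
      field_simp
      ring
    rw [← hval]
    refine hlog.congr' ?_
    filter_upwards [eventually_gt_atTop 0] with t ht
    exact (key t ht).symm
  have hint : IntegrableOn (fun t : ℝ => ((t : ℂ) ^ 2 + w)⁻¹) (Ioi 0) :=
    (integrable_inv_sq_add hw).integrableOn
  rw [integral_Ioi_of_hasDerivAt_of_tendsto hcontA hderiv hint hlim]
  simp [hA]

/-- **`∫_ℝ dt/(t² + w) = π / w^{1/2}`** for `w` in the slit plane. [folklore] -/
theorem integral_inv_sq_add_of_mem_slitPlane {w : ℂ} (hw : w ∈ slitPlane) :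
    ∫ t : ℝ, ((t : ℂ) ^ 2 + w)⁻¹ = π / w ^ (1 / 2 : ℂ) := by
  have hint := integrable_inv_sq_add hw
  have hsplit := integral_add_compl (measurableSet_Ioi (a := (0 : ℝ))) hint
  rw [← hsplit]
  have hcompl : (Ioi (0 : ℝ))ᶜ = Iic 0 := compl_Ioi
  rw [hcompl]
  have hneg : ∫ t : ℝ in Iic 0, ((t : ℂ) ^ 2 + w)⁻¹ = ∫ t : ℝ in Ioi 0, ((t : ℂ) ^ 2 + w)⁻¹ := by
    rw [← neg_zero, ← integral_comp_neg_Ioi (f := fun t : ℝ => ((t : ℂ) ^ 2 + w)⁻¹)]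
    simp
  rw [hneg, integral_Ioi_inv_sq_add_of_mem_slitPlane hw]
  have hr0 : w ^ (1 / 2 : ℂ) ≠ 0 := by
    intro h
    have hx := re_cpow_half_pos hw
    rw [h, Complex.zero_re] at hx
    exact lt_irrefl _ hx
  field_simp
  ring



/-! ### `∫₀^{2π} dθ/(z - cos θ)` by the Cauchy integral formula -/

/-- On the unit circle `u = e^{iθ}`, `u i (u - ζ₁)⁻¹ · 2i/(u - ζ₂) = 1/(z - cos θ)` when
`ζ₁ + ζ₂ = 2z`, `ζ₁ ζ₂ = 1`. [folklore] -/
theorem circleIntegrand_inv_sub_cos {z ζ₁ ζ₂ u : ℂ} (hsum : ζ₁ + ζ₂ = 2 * z) (hprod : ζ₁ * ζ₂ = 1)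
    (hu : u ≠ 0) (h1 : u ≠ ζ₁) (h2 : u ≠ ζ₂) :
    u * I * ((u - ζ₁)⁻¹ * (2 * I / (u - ζ₂))) = (z - (u + u⁻¹) / 2)⁻¹ := by
  have h1' : u - ζ₁ ≠ 0 := sub_ne_zero.2 h1
  have h2' : u - ζ₂ ≠ 0 := sub_ne_zero.2 h2
  have hquad : (u - ζ₁) * (u - ζ₂) = u ^ 2 - 2 * z * u + 1 := by
    have : (u - ζ₁) * (u - ζ₂) = u ^ 2 - (ζ₁ + ζ₂) * u + ζ₁ * ζ₂ := by ring
    rw [this, hsum, hprod]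
  have hq0 : u ^ 2 - 2 * z * u + 1 ≠ 0 := by
    rw [← hquad]; exact mul_ne_zero h1' h2'
  have hden : z - (u + u⁻¹) / 2 ≠ 0 := by
    intro h
    apply hq0
    have : u ^ 2 - 2 * z * u + 1 = -2 * u * (z - (u + u⁻¹) / 2) := by
      field_simp
      ring
    rw [this, h, mul_zero]
  refine eq_inv_of_mul_eq_one_left ?_
  have eA : (u - ζ₁)⁻¹ * (2 * I / (u - ζ₂)) = 2 * I / (u ^ 2 - 2 * z * u + 1) := by
    rw [← hquad]
    field_simp
  have eB : z - (u + u⁻¹) / 2 = -(u ^ 2 - 2 * z * u + 1) / (2 * u) := by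
    field_simp
    ring
  rw [eA, eB]
  have e3 : u * I * (2 * I / (u ^ 2 - 2 * z * u + 1)) * (-(u ^ 2 - 2 * z * u + 1) / (2 * u)) =
      -(I * I) * ((2 * u) / (2 * u)) * ((u ^ 2 - 2 * z * u + 1) / (u ^ 2 - 2 * z * u + 1)) := by
    ring
  rw [e3, div_self hq0, div_self (mul_ne_zero two_ne_zero hu), Complex.I_mul_I]
  ring



/-- Cauchy's formula on the unit circle: with the roots `ζ₁` (inside) and `ζ₂` (outside) of
`ζ² - 2zζ + 1`, `∫₀^{2π} dθ/(z - cos θ) = 4π/(ζ₂ - ζ₁)`. [folklore] -/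
theorem integral_inv_sub_cos_aux {z ζ₁ ζ₂ : ℂ} (hsum : ζ₁ + ζ₂ = 2 * z) (hprod : ζ₁ * ζ₂ = 1)
    (h1 : ‖ζ₁‖ < 1) (h2 : 1 < ‖ζ₂‖) :
    ∫ θ in (0 : ℝ)..2 * π, (z - Complex.cos θ)⁻¹ = 4 * π / (ζ₂ - ζ₁) := by
  set f : ℂ → ℂ := fun ζ => 2 * I / (ζ - ζ₂) with hf
  have hfd : DifferentiableOn ℂ f (closedBall 0 1) := by
    intro ζ hζ
    have hne : ζ - ζ₂ ≠ 0 := by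
      intro h
      rw [sub_eq_zero] at h
      rw [h, mem_closedBall_zero_iff] at hζ
      linarith
    exact ((differentiableAt_const _).div ((differentiableAt_id).sub_const ζ₂)
      hne).differentiableWithinAt
  have hζ₁ : ζ₁ ∈ ball (0 : ℂ) 1 := by simpa using h1
  have hC := hfd.circleIntegral_sub_inv_smul hζ₁
  rw [circleIntegral] at hC
  have hint : ∫ θ in (0 : ℝ)..2 * π, (z - Complex.cos θ)⁻¹ =
      ∫ θ in (0 : ℝ)..2 * π, deriv (circleMap 0 1) θ •
        ((circleMap 0 1 θ - ζ₁)⁻¹ • f (circleMap 0 1 θ)) := by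
    refine intervalIntegral.integral_congr fun θ _ => ?_
    simp only [deriv_circleMap, circleMap_zero, hf, smul_eq_mul, Complex.ofReal_one, one_mul]
    set u := Complex.exp (θ * I) with hu
    have hu1 : ‖u‖ = 1 := by rw [hu]; exact Complex.norm_exp_ofReal_mul_I θ
    have hu0 : u ≠ 0 := by rw [hu]; exact Complex.exp_ne_zero _
    have hne1 : u ≠ ζ₁ := fun h => by rw [← h, hu1] at h1; exact lt_irrefl _ h1
    have hne2 : u ≠ ζ₂ := fun h => by rw [← h, hu1] at h2; exact lt_irrefl _ h2
    have hcos : Complex.cos θ = (u + u⁻¹) / 2 := by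
      have h2c := Complex.two_cos (θ : ℂ)
      rw [neg_mul, Complex.exp_neg, ← hu] at h2c
      rw [← h2c]
      ring
    rw [hcos]
    exact (circleIntegrand_inv_sub_cos hsum hprod hu0 hne1 hne2).symm
  rw [hint, hC, hf]
  simp only [smul_eq_mul]
  have hne : ζ₁ - ζ₂ ≠ 0 := by
    rw [sub_ne_zero]
    intro h
    rw [h] at h1
    linarith
  have hne' : ζ₂ - ζ₁ ≠ 0 := by
    intro h; apply hne; linear_combination -h
  field_simp
  ring_nf
  rw [Complex.I_sq]
  ring

/-- **`∫₀^{2π} dθ/(z - cos θ) = 2π/D` with `D² = z² - 1`**, for `Im z > 0`. [folklore] -/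
theorem integral_inv_sub_cos {z : ℂ} (hz : 0 < z.im) :
    ∃ D : ℂ, D ^ 2 = z ^ 2 - 1 ∧ D ≠ 0 ∧
      ∫ θ in (0 : ℝ)..2 * π, (z - Complex.cos θ)⁻¹ = 2 * π / D := by
  have hz1 : z ^ 2 - 1 ≠ 0 := by
    intro h
    have h' : (z - 1) * (z + 1) = 0 := by linear_combination h
    rcases mul_eq_zero.1 h' with h'' | h''
    · have := congrArg Complex.im h''
      simp at this
      linarith
    · have := congrArg Complex.im h''
      simp at this
      linarith
  set E := (z ^ 2 - 1) ^ (1 / 2 : ℂ) with hE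
  have hEE : E * E = z ^ 2 - 1 := cpow_half_mul_self hz1
  have hE0 : E ≠ 0 := fun h => hz1 (by rw [← hEE, h, mul_zero])
  set ζ₁ := z - E with hζ₁
  set ζ₂ := z + E with hζ₂
  have hsum : ζ₁ + ζ₂ = 2 * z := by rw [hζ₁, hζ₂]; ring
  have hprod : ζ₁ * ζ₂ = 1 := by
    rw [hζ₁, hζ₂]
    linear_combination -hEE
  have hnorm : ‖ζ₁‖ * ‖ζ₂‖ = 1 := by rw [← norm_mul, hprod, norm_one]
  have hne1 : ‖ζ₁‖ ≠ 1 := by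
    intro h
    have hinv : ζ₂ = (starRingEnd ℂ) ζ₁ := by
      rw [← Complex.inv_eq_conj h]
      exact (eq_inv_of_mul_eq_one_right hprod)
    have him : (ζ₁ + ζ₂).im = 0 := by
      rw [hinv, Complex.add_im, Complex.conj_im]
      ring
    rw [hsum] at him
    simp at him
    linarith
  rcases lt_or_gt_of_ne hne1 with hlt | hgt
  · have h2 : 1 < ‖ζ₂‖ := by
      by_contra hle
      rw [not_lt] at hle
      have : ‖ζ₁‖ * ‖ζ₂‖ < 1 * 1 :=
        mul_lt_mul' hlt.le (lt_of_le_of_ne hle ?_) (norm_nonneg _) one_pos |>.trans_eq' ?_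
      · linarith
      · intro h; rw [h] at hnorm; linarith
      · ring
    refine ⟨E, by rw [sq]; exact hEE, hE0, ?_⟩
    rw [integral_inv_sub_cos_aux hsum hprod hlt h2]
    have : ζ₂ - ζ₁ = 2 * E := by rw [hζ₁, hζ₂]; ring
    rw [this]
    field_simp
    ring
  · have h2 : ‖ζ₂‖ < 1 := by
      by_contra hle
      rw [not_lt] at hle
      have : 1 * 1 < ‖ζ₁‖ * ‖ζ₂‖ := mul_lt_mul hgt hle one_pos (norm_nonneg _)
      linarith
    refine ⟨-E, by rw [neg_sq, sq]; exact hEE, neg_ne_zero.2 hE0, ?_⟩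
    rw [integral_inv_sub_cos_aux ((add_comm _ _).trans hsum) ((mul_comm _ _).trans hprod) h2 hgt]
    have : ζ₁ - ζ₂ = -(2 * E) := by rw [hζ₁, hζ₂]; ring
    rw [this]
    field_simp
    ring


/-! ### The Poisson integral `∫₀^π c dθ/(c² + (s - cos θ)²)` in closed form -/

/-- For `z = s + ic` with `c > 0`, `1 - z² = (1 - s² + c²) - 2sc·i` lies in the slit plane.
[folklore] -/
theorem one_sub_sq_mem_slitPlane (s : ℝ) {c : ℝ} (hc : 0 < c) :
    (1 - ((s : ℂ) + c * I) ^ 2) ∈ slitPlane := by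
  have hre : (1 - ((s : ℂ) + c * I) ^ 2).re = 1 - s ^ 2 + c ^ 2 := by
    simp [sq, Complex.mul_re, Complex.mul_im]
    ring
  have him : (1 - ((s : ℂ) + c * I) ^ 2).im = -(2 * s * c) := by
    simp [sq, Complex.mul_re, Complex.mul_im]
    ring
  rcases eq_or_ne s 0 with rfl | hs
  · left
    rw [hre]
    positivity
  · right
    rw [him, neg_ne_zero]
    positivity

/-- The imaginary part of `1/(z - cos θ)`, `z = s + ic`: `-c/(c² + (s - cos θ)²)`. [folklore] -/
theorem im_inv_add_mul_I_sub_cos (s c θ : ℝ) :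
    (((s : ℂ) + c * I - Complex.cos θ)⁻¹).im = -(c / (c ^ 2 + (s - Real.cos θ) ^ 2)) := by
  rw [Complex.inv_im]
  have hn : Complex.normSq ((s : ℂ) + c * I - Complex.cos θ) = c ^ 2 + (s - Real.cos θ) ^ 2 := by
    rw [Complex.normSq_apply]
    simp [Complex.cos_ofReal_re, Complex.cos_ofReal_im]
    ring
  rw [hn]
  simp [Complex.cos_ofReal_im, neg_div]

/-- `z - cos θ ≠ 0` for `z = s + ic`, `c > 0`. [folklore] -/
theorem add_mul_I_sub_cos_ne_zero (s c θ : ℝ) (hc : 0 < c) : (s : ℂ) + c * I - Complex.cos θ ≠ 0 := by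
  intro h
  have := congrArg Complex.im h
  rw [← Complex.ofReal_cos] at this
  simp at this
  exact hc.ne' this

/-- **`∫₀^{2π} c dθ/(c² + (s - cos θ)²) = -2π Im(D⁻¹)`** with `D² = z² - 1`, `z = s + ic`.
[folklore] -/
theorem integral_two_pi_poissonCos {s c : ℝ} (hc : 0 < c) :
    ∃ D : ℂ, D ^ 2 = ((s : ℂ) + c * I) ^ 2 - 1 ∧ D ≠ 0 ∧
      ∫ θ in (0 : ℝ)..2 * π, c / (c ^ 2 + (s - Real.cos θ) ^ 2) = -(2 * π * (D⁻¹).im) := by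
  set z : ℂ := (s : ℂ) + c * I with hz
  have hzim : 0 < z.im := by simp [hz, hc]
  obtain ⟨D, hD2, hD0, hint⟩ := integral_inv_sub_cos hzim
  refine ⟨D, hD2, hD0, ?_⟩
  have hcont : Continuous fun θ : ℝ => (z - Complex.cos θ)⁻¹ :=
    Continuous.inv₀ (by fun_prop) fun θ => add_mul_I_sub_cos_ne_zero s c θ hc
  have him := intervalIntegral_im (hcont.intervalIntegrable 0 (2 * π)) (μ := volume)
  simp only [RCLike.im_to_complex] at him
  rw [hint] at him
  have hfun : (fun θ : ℝ => (z - Complex.cos θ)⁻¹.im) =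
      fun θ => -(c / (c ^ 2 + (s - Real.cos θ) ^ 2)) := by
    funext θ
    exact im_inv_add_mul_I_sub_cos s c θ
  rw [hfun, intervalIntegral.integral_neg] at him
  have hval : (2 * π / D : ℂ).im = 2 * π * (D⁻¹).im := by
    rw [div_eq_mul_inv]
    have : (2 * π : ℂ) = ((2 * π : ℝ) : ℂ) := by push_cast; ring
    rw [this, Complex.im_ofReal_mul]
  rw [hval] at him
  linarith

/-- **`∫₀^{π} c dθ/(c² + (s - cos θ)²) = -π Im(D⁻¹)`** (the integrand is symmetric under
`θ ↦ 2π - θ`). [folklore] -/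
theorem integral_pi_poissonCos {s c : ℝ} (hc : 0 < c) :
    ∃ D : ℂ, D ^ 2 = ((s : ℂ) + c * I) ^ 2 - 1 ∧ D ≠ 0 ∧
      ∫ θ in (0 : ℝ)..π, c / (c ^ 2 + (s - Real.cos θ) ^ 2) = -(π * (D⁻¹).im) := by
  obtain ⟨D, hD2, hD0, hint⟩ := integral_two_pi_poissonCos (s := s) hc
  refine ⟨D, hD2, hD0, ?_⟩
  set q : ℝ → ℝ := fun θ => c / (c ^ 2 + (s - Real.cos θ) ^ 2) with hq
  have hqc : Continuous q := by
    refine Continuous.div continuous_const (by fun_prop) fun θ => ?_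
    positivity
  have hsplit : ∫ θ in (0 : ℝ)..2 * π, q θ = (∫ θ in (0 : ℝ)..π, q θ) + ∫ θ in π..2 * π, q θ :=
    (integral_add_adjacent_intervals (hqc.intervalIntegrable _ _) (hqc.intervalIntegrable _ _)).symm
  have hsymm : ∫ θ in π..2 * π, q θ = ∫ θ in (0 : ℝ)..π, q θ := by
    have h := intervalIntegral.integral_comp_sub_left q (2 * π) (a := 0) (b := π)
    have e1 : 2 * π - π = π := by ring
    have e2 : 2 * π - 0 = 2 * π := by ring
    rw [e1, e2] at h
    rw [← h]
    refine intervalIntegral.integral_congr fun θ _ => ?_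
    simp only [hq, Real.cos_two_pi_sub]
  have h2 : ∫ θ in (0 : ℝ)..2 * π, q θ = 2 * ∫ θ in (0 : ℝ)..π, q θ := by
    rw [hsplit, hsymm]; ring
  have hint' : ∫ θ in (0 : ℝ)..2 * π, q θ = -(2 * π * (D⁻¹).im) := hint
  rw [h2] at hint'
  change ∫ θ in (0 : ℝ)..π, q θ = -(π * (D⁻¹).im)
  linarith

/-- The `θ`-integral is positive. [folklore] -/
theorem integral_pi_poissonCos_pos (s : ℝ) {c : ℝ} (hc : 0 < c) :
    0 < ∫ θ in (0 : ℝ)..π, c / (c ^ 2 + (s - Real.cos θ) ^ 2) := by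
  have hqc : Continuous fun θ : ℝ => c / (c ^ 2 + (s - Real.cos θ) ^ 2) := by
    refine Continuous.div continuous_const (by fun_prop) fun θ => ?_
    positivity
  exact intervalIntegral.intervalIntegral_pos_of_pos_on (hqc.intervalIntegrable _ _)
    (fun θ _ => by positivity) Real.pi_pos

/-- **The identity (I4)**: for `c > 0` and real `s`, with `z = s + ic`,
`∫₀^π c dθ/(c² + (s - cos θ)²) = ∫_ℝ Re[(t² + 1 - z²)⁻¹] dt`. [folklore] -/
theorem integral_pi_poissonCos_eq_integral_re {s c : ℝ} (hc : 0 < c) :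
    ∫ θ in (0 : ℝ)..π, c / (c ^ 2 + (s - Real.cos θ) ^ 2) =
      ∫ t : ℝ, (((t : ℂ) ^ 2 + (1 - ((s : ℂ) + c * I) ^ 2))⁻¹).re := by
  set z : ℂ := (s : ℂ) + c * I with hz
  set w : ℂ := 1 - z ^ 2 with hw
  have hws : w ∈ slitPlane := one_sub_sq_mem_slitPlane s hc
  set B : ℂ := w ^ (1 / 2 : ℂ) with hB
  have hBre : 0 < B.re := re_cpow_half_pos hws
  have hB0 : B ≠ 0 := fun h => by rw [h, Complex.zero_re] at hBre; exact lt_irrefl _ hBre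
  have hBB : B * B = w := cpow_half_mul_self (slitPlane_ne_zero hws)
  -- the right-hand side
  have hR : ∫ t : ℝ, (((t : ℂ) ^ 2 + w)⁻¹).re = (π / B).re := by
    rw [← integral_inv_sq_add_of_mem_slitPlane hws]
    have := integral_re (integrable_inv_sq_add hws)
    simpa using this
  -- the left-hand side
  obtain ⟨D, hD2, hD0, hL⟩ := integral_pi_poissonCos (s := s) hc
  have hpos := integral_pi_poissonCos_pos s hc
  rw [hL] at hpos ⊢
  rw [hR]
  -- `D = ± iB`
  have hDB : D = I * B ∨ D = -(I * B) := by
    have h0 : (D - I * B) * (D + I * B) = 0 := by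
      have : (D - I * B) * (D + I * B) = D ^ 2 - I ^ 2 * (B * B) := by ring
      rw [this, Complex.I_sq, hBB, hD2, hw]
      ring
    rcases mul_eq_zero.1 h0 with h | h
    · exact Or.inl (sub_eq_zero.1 h)
    · exact Or.inr (add_eq_zero_iff_eq_neg.1 h)
  have hBinv : 0 < (B⁻¹).re := by
    rw [Complex.inv_re]
    exact div_pos hBre (Complex.normSq_pos.2 hB0)
  have hval : (π / B : ℂ).re = π * (B⁻¹).re := by
    rw [div_eq_mul_inv, Complex.re_ofReal_mul]
  rcases hDB with h | h
  · -- `D = iB`: `D⁻¹ = -i B⁻¹`, `Im D⁻¹ = -Re B⁻¹`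
    rw [h, mul_inv, Complex.inv_I, hval]
    simp [Complex.mul_im]
  · -- `D = -iB` contradicts positivity
    exfalso
    rw [h, inv_neg, mul_inv, Complex.inv_I] at hpos
    simp [Complex.mul_im] at hpos
    have : 0 < π * (B.re / Complex.normSq B) :=
      mul_pos Real.pi_pos (div_pos hBre (Complex.normSq_pos.2 hB0))
    linarith



/-! ### The mixture kernel: `Re (t² + 1 - z²)⁻¹` -/

/-- The **mixture kernel** `m(c, s, t) = (1/(2b)) [(b-s)/((b-s)² + c²) + (b+s)/((b+s)² + c²)]`,
`b = √(1 + t²)`: a positive combination of Cauchy densities in the variable `c`. [folklore] -/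
def cauchyMixKernel (c s t : ℝ) : ℝ :=
  1 / (2 * √(1 + t ^ 2)) * ((√(1 + t ^ 2) - s) / ((√(1 + t ^ 2) - s) ^ 2 + c ^ 2) +
    (√(1 + t ^ 2) + s) / ((√(1 + t ^ 2) + s) ^ 2 + c ^ 2))

/-- `Re[(t² + 1 - z²)⁻¹] = m(c, s, t)` for `z = s + ic`, `c > 0`. [folklore] -/
theorem re_inv_sq_add_one_sub_sq (s t : ℝ) {c : ℝ} (hc : 0 < c) :
    (((t : ℂ) ^ 2 + (1 - ((s : ℂ) + c * I) ^ 2))⁻¹).re = cauchyMixKernel c s t := by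
  set b := √(1 + t ^ 2) with hb
  have hb0 : 0 < b := Real.sqrt_pos.2 (by positivity)
  have hbb : b ^ 2 = 1 + t ^ 2 := Real.sq_sqrt (by positivity)
  set z : ℂ := (s : ℂ) + c * I with hz
  have hbC : (b : ℂ) ^ 2 = 1 + (t : ℂ) ^ 2 := by
    have := congrArg (fun x : ℝ => (x : ℂ)) hbb
    push_cast at this
    exact this
  have hfac : (t : ℂ) ^ 2 + (1 - z ^ 2) = ((b : ℂ) - z) * ((b : ℂ) + z) := by
    have e : ((b : ℂ) - z) * ((b : ℂ) + z) = (b : ℂ) ^ 2 - z ^ 2 := by ring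
    rw [e, hbC]
    ring
  have h1 : (b : ℂ) - z ≠ 0 := by
    intro h; have := congrArg Complex.im h; simp [hz] at this; linarith
  have h2 : (b : ℂ) + z ≠ 0 := by
    intro h; have := congrArg Complex.im h; simp [hz] at this; linarith
  have hb0' : (b : ℂ) ≠ 0 := Complex.ofReal_ne_zero.2 hb0.ne'
  have hpf : (((b : ℂ) - z) * ((b : ℂ) + z))⁻¹ =
      ((1 / (2 * b) : ℝ) : ℂ) * (((b : ℂ) - z)⁻¹ + ((b : ℂ) + z)⁻¹) := by
    push_cast
    field_simp
    ring
  rw [hfac, hpf, Complex.re_ofReal_mul, Complex.add_re, Complex.inv_re, Complex.inv_re]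
  have n1 : Complex.normSq ((b : ℂ) - z) = (b - s) ^ 2 + c ^ 2 := by
    rw [Complex.normSq_apply]; simp [hz]; ring
  have n2 : Complex.normSq ((b : ℂ) + z) = (b + s) ^ 2 + c ^ 2 := by
    rw [Complex.normSq_apply]; simp [hz]; ring
  have r1 : ((b : ℂ) - z).re = b - s := by simp [hz]
  have r2 : ((b : ℂ) + z).re = b + s := by simp [hz]
  rw [n1, n2, r1, r2, cauchyMixKernel]

/-- **(I4), real form**: `∫₀^π c dθ/(c² + (s - cos θ)²) = ∫_ℝ m(c, s, t) dt` for `c > 0`.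
[folklore] -/
theorem integral_pi_poissonCos_eq_integral_cauchyMixKernel (s : ℝ) {c : ℝ} (hc : 0 < c) :
    ∫ θ in (0 : ℝ)..π, c / (c ^ 2 + (s - Real.cos θ) ^ 2) = ∫ t : ℝ, cauchyMixKernel c s t := by
  rw [integral_pi_poissonCos_eq_integral_re hc]
  exact integral_congr_ae (Eventually.of_forall fun t => re_inv_sq_add_one_sub_sq s t hc)

/-! ### Properties of the mixture kernel (`|s| < 1`) -/

/-- `1 ≤ √(1 + t²)`. [folklore] -/
theorem one_le_sqrt_one_add_sq (t : ℝ) : 1 ≤ √(1 + t ^ 2) := by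
  rw [Real.le_sqrt (by norm_num) (by positivity)]
  nlinarith [sq_nonneg t]

/-- For `|s| < 1`: `b - s > 0` and `b + s > 0`, `b = √(1+t²)`. [folklore] -/
theorem sqrt_one_add_sq_sub_pos {s : ℝ} (hs : |s| < 1) (t : ℝ) : 0 < √(1 + t ^ 2) - s := by
  have := one_le_sqrt_one_add_sq t
  have := (abs_lt.1 hs).2
  linarith

/-- For `|s| < 1`: `√(1 + t²) + s > 0`. [folklore] -/
theorem sqrt_one_add_sq_add_pos {s : ℝ} (hs : |s| < 1) (t : ℝ) : 0 < √(1 + t ^ 2) + s := by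
  have := one_le_sqrt_one_add_sq t
  have := (abs_lt.1 hs).1
  linarith

/-- The mixture kernel is nonnegative (`|s| < 1`). [folklore] -/
theorem cauchyMixKernel_nonneg (c : ℝ) {s : ℝ} (hs : |s| < 1) (t : ℝ) : 0 ≤ cauchyMixKernel c s t := by
  have h1 := sqrt_one_add_sq_sub_pos hs t
  have h2 := sqrt_one_add_sq_add_pos hs t
  have hb : 0 < √(1 + t ^ 2) := by linarith [(abs_lt.1 hs).2]
  unfold cauchyMixKernel
  positivity

/-- Each Cauchy profile `β/(β² + c²)` is decreasing in `c ≥ 0` for `β > 0`. [folklore] -/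
theorem div_sq_add_sq_antitone {β c₁ c₂ : ℝ} (hβ : 0 < β) (hc₁ : 0 ≤ c₁) (h : c₁ ≤ c₂) :
    β / (β ^ 2 + c₂ ^ 2) ≤ β / (β ^ 2 + c₁ ^ 2) := by
  apply div_le_div_of_nonneg_left hβ.le (by positivity)
  nlinarith

/-- Strict version. [folklore] -/
theorem div_sq_add_sq_strictAnti {β c₁ c₂ : ℝ} (hβ : 0 < β) (hc₁ : 0 ≤ c₁) (h : c₁ < c₂) :
    β / (β ^ 2 + c₂ ^ 2) < β / (β ^ 2 + c₁ ^ 2) := by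
  apply div_lt_div_of_pos_left hβ (by positivity)
  nlinarith

/-- The mixture kernel is decreasing in `c ≥ 0`. [folklore] -/
theorem cauchyMixKernel_antitone {s : ℝ} (hs : |s| < 1) (t : ℝ) {c₁ c₂ : ℝ} (hc₁ : 0 ≤ c₁)
    (h : c₁ ≤ c₂) : cauchyMixKernel c₂ s t ≤ cauchyMixKernel c₁ s t := by
  have h1 := sqrt_one_add_sq_sub_pos hs t
  have h2 := sqrt_one_add_sq_add_pos hs t
  have hb : 0 < √(1 + t ^ 2) := by linarith [(abs_lt.1 hs).2]
  unfold cauchyMixKernel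
  have e1 := div_sq_add_sq_antitone h1 hc₁ h
  have e2 := div_sq_add_sq_antitone h2 hc₁ h
  have : 0 ≤ 1 / (2 * √(1 + t ^ 2)) := by positivity
  exact mul_le_mul_of_nonneg_left (add_le_add e1 e2) this

/-- The mixture kernel is strictly decreasing in `c ≥ 0`. [folklore] -/
theorem cauchyMixKernel_strictAnti {s : ℝ} (hs : |s| < 1) (t : ℝ) {c₁ c₂ : ℝ} (hc₁ : 0 ≤ c₁)
    (h : c₁ < c₂) : cauchyMixKernel c₂ s t < cauchyMixKernel c₁ s t := by
  have h1 := sqrt_one_add_sq_sub_pos hs t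
  have h2 := sqrt_one_add_sq_add_pos hs t
  have hb : 0 < √(1 + t ^ 2) := by linarith [(abs_lt.1 hs).2]
  unfold cauchyMixKernel
  have e1 := div_sq_add_sq_strictAnti h1 hc₁ h
  have e2 := div_sq_add_sq_strictAnti h2 hc₁ h
  have : 0 < 1 / (2 * √(1 + t ^ 2)) := by positivity
  exact mul_lt_mul_of_pos_left (add_lt_add e1 e2) this

/-- The value at `c = 0`: `m(0, s, t) = 1/(1 + t² - s²)`. [folklore] -/
theorem cauchyMixKernel_zero {s : ℝ} (hs : |s| < 1) (t : ℝ) : cauchyMixKernel 0 s t = 1 / (1 + t ^ 2 - s ^ 2) := by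
  have h1 := sqrt_one_add_sq_sub_pos hs t
  have h2 := sqrt_one_add_sq_add_pos hs t
  unfold cauchyMixKernel
  set b := √(1 + t ^ 2) with hb
  have hb0 : 0 < b := by linarith [(abs_lt.1 hs).2]
  have hbb : b ^ 2 = 1 + t ^ 2 := Real.sq_sqrt (by positivity)
  rw [← hbb]
  have h3 : b ^ 2 - s ^ 2 ≠ 0 := by
    have : b ^ 2 - s ^ 2 = (b - s) * (b + s) := by ring
    rw [this]; positivity
  have h4 : (b - s) ^ 2 + 0 ^ 2 ≠ 0 := by positivity
  have h5 : (b + s) ^ 2 + 0 ^ 2 ≠ 0 := by positivity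
  field_simp
  ring

/-- The bound `m(c, s, t) ≤ 1/((1 - |s|)(1 + t²))`. [folklore] -/
theorem cauchyMixKernel_le {s : ℝ} (hs : |s| < 1) (c t : ℝ) :
    cauchyMixKernel c s t ≤ (1 - |s|)⁻¹ * (1 + t ^ 2)⁻¹ := by
  set b := √(1 + t ^ 2) with hb
  have hb1 : 1 ≤ b := one_le_sqrt_one_add_sq t
  have h1 : 0 < b - s := sqrt_one_add_sq_sub_pos hs t
  have h2 : 0 < b + s := sqrt_one_add_sq_add_pos hs t
  have hb0 : 0 < b := by linarith
  have hbb : b ^ 2 = 1 + t ^ 2 := Real.sq_sqrt (by positivity)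
  have hs1 : 0 < 1 - |s| := by linarith
  -- each profile is at most `1/β ≤ 1/((1-|s|) b)`
  have hkey : ∀ β : ℝ, b - |s| ≤ β → 0 < β → β / (β ^ 2 + c ^ 2) ≤ 1 / ((1 - |s|) * b) := by
    intro β hβ hβ0
    have hβs : (1 - |s|) * b ≤ β := by nlinarith [abs_nonneg s]
    calc β / (β ^ 2 + c ^ 2) ≤ β / β ^ 2 := by
          apply div_le_div_of_nonneg_left hβ0.le (by positivity); nlinarith
      _ = 1 / β := by field_simp
      _ ≤ 1 / ((1 - |s|) * b) := by
          apply one_div_le_one_div_of_le (by positivity) hβs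
  have e1 := hkey (b - s) (by linarith [le_abs_self s]) h1
  have e2 := hkey (b + s) (by linarith [neg_abs_le s]) h2
  unfold cauchyMixKernel
  rw [← hb]
  calc 1 / (2 * b) * ((b - s) / ((b - s) ^ 2 + c ^ 2) + (b + s) / ((b + s) ^ 2 + c ^ 2))
      ≤ 1 / (2 * b) * (1 / ((1 - |s|) * b) + 1 / ((1 - |s|) * b)) := by
        gcongr
    _ = (1 - |s|)⁻¹ * (1 + t ^ 2)⁻¹ := by
        rw [← hbb]
        field_simp
        ring

/-- Continuity of the mixture kernel in `t`. [folklore] -/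
theorem continuous_cauchyMixKernel (c : ℝ) {s : ℝ} (hs : |s| < 1) : Continuous fun t => cauchyMixKernel c s t := by
  have hb : Continuous fun t : ℝ => √(1 + t ^ 2) := by fun_prop
  unfold cauchyMixKernel
  refine Continuous.mul ?_ (Continuous.add ?_ ?_)
  · refine Continuous.div continuous_const (by fun_prop) fun t => ?_
    have := one_le_sqrt_one_add_sq t
    positivity
  · refine Continuous.div (by fun_prop) (by fun_prop) fun t => ?_
    have := sqrt_one_add_sq_sub_pos hs t
    positivity
  · refine Continuous.div (by fun_prop) (by fun_prop) fun t => ?_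
    have := sqrt_one_add_sq_add_pos hs t
    positivity

/-- Integrability of the mixture kernel in `t`. [folklore] -/
theorem integrable_cauchyMixKernel (c : ℝ) {s : ℝ} (hs : |s| < 1) : Integrable fun t => cauchyMixKernel c s t := by
  refine Integrable.mono' (integrable_inv_one_add_sq.const_mul (1 - |s|)⁻¹)
    (continuous_cauchyMixKernel c hs).aestronglyMeasurable (Eventually.of_forall fun t => ?_)
  rw [Real.norm_eq_abs, abs_of_nonneg (cauchyMixKernel_nonneg c hs t)]
  exact cauchyMixKernel_le hs c t

/-- `∫_ℝ dt/(t² + r²) = π/r` for `r > 0`. [folklore] -/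
theorem integral_inv_sq_add_sq {r : ℝ} (hr : 0 < r) : ∫ t : ℝ, 1 / (t ^ 2 + r ^ 2) = π / r := by
  have h : (fun t : ℝ => 1 / (t ^ 2 + r ^ 2)) = fun t => (r ^ 2)⁻¹ * (1 + (r⁻¹ * t) ^ 2)⁻¹ := by
    funext t
    field_simp
    ring
  rw [h, MeasureTheory.integral_const_mul]
  have := Measure.integral_comp_mul_left (fun y : ℝ => (1 + y ^ 2)⁻¹) r⁻¹
  rw [this, integral_univ_inv_one_add_sq, inv_inv, abs_of_pos hr, smul_eq_mul]
  field_simp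

/-- `∫_ℝ m(0, s, t) dt = π/√(1 - s²)` for `|s| < 1`. [folklore] -/
theorem integral_cauchyMixKernel_zero {s : ℝ} (hs : |s| < 1) :
    ∫ t : ℝ, cauchyMixKernel 0 s t = π / √(1 - s ^ 2) := by
  have hs2 : 0 < 1 - s ^ 2 := by
    have := abs_lt.1 hs
    nlinarith
  have hr : 0 < √(1 - s ^ 2) := Real.sqrt_pos.2 hs2
  have hrr : √(1 - s ^ 2) ^ 2 = 1 - s ^ 2 := Real.sq_sqrt hs2.le
  rw [← integral_inv_sq_add_sq hr]
  refine integral_congr_ae (Eventually.of_forall fun t => ?_)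
  simp only [cauchyMixKernel_zero hs, hrr]
  ring_nf

end Literature.Analysis.SpecialFunctions
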